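import Literature.Probability.Percolation.BondPercolationSymmetry
import Summits.CriticalPhenomena.PercolationContinuityZ3.Theses.PercThresholdOne
import HarnessLib

/-!
# Route `PercThresholdOne`, item `IsoperimetricClosing` (stmt-CriticalPhenomena-5263)

The second-leg assembly of the route: the three inlined hypotheses

* (GenDembin) every translation-invariant probability measure on nearest-neighbour bond
  configurations of `ℤ³` that a.s. WEAVES (all half-space clusters finite) has a.s. a VANISHING
  anchored isoperimetric profile: for every `c > 0` and `N` there are `n ≥ N` and a valid `K ∋ 0`
  (`0` joined to every point of `K` by open paths inside `K`, `|K| ≤ n³`) with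
  `n · |∂°K| ≤ c · |K|` (`∂°K` = open edges of the edge boundary of `K`);
* (CriticalConfigWeaves) `P_{p_c}`-a.s. the critical configuration of `ℤ³` weaves;
* (SamePAnchoredIsoperimetry) whenever `θ(p) > 0`, `P_p`-a.s. on `{|C(0)| = ∞}` there are `c > 0`, `N`
  with `c · |K| ≤ n · |∂°K|` for all `n ≥ N` and all valid `K`;

give `θ(p_c) = 0` on `ℤ³` (`PercolationContinuityZ3`).

Proof (Cerf–Dembin 2020, proof of Thm 1.2 ⇒ `θ(p_c) = 0` given positivity of the profile, pure
logic once the inputs are named). Suppose `θ(p_c) ≠ 0`, so `θ(p_c) > 0`. `P_{p_c}` is a probability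
measure, translation invariant (`bondPercolation_map_shift`: the map `ξ ↦ (· + a)⁻¹ ξ` of the hypothesis
is the relabelling `BondConfig.relabel (sym2Equiv (Site.shift (-a)))`), a.s. supported on lattice edges
(`setBernoulli_ae_subset`) and a.s. weaving (second hypothesis); so GenDembin applies. On
`{|C(0)| = ∞}` the third hypothesis at `p = p_c` gives `c₀ > 0`, `N₀`; GenDembin with `c = c₀ / 2`, `N = N₀`
gives `n ≥ N₀` and a valid `K ∋ 0` with `c₀ |K| ≤ n |∂°K| ≤ (c₀/2) |K|`, impossible as `|K| ≥ 1`.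
Hence `|C(0)| < ∞` a.s., i.e. `θ(p_c) = P_{p_c}(|C(0)| = ∞) = 0`.
-/

namespace Summit.CriticalPhenomena.PercolationContinuityZ3.Theorems

open MeasureTheory
open Literature.Probability.Percolation Literature.Probability.LatticeModels

/-- The translation map `ξ ↦ {e | e + a ∈ ξ}` of bond configurations of `ℤ^d` used in the route's
invariance hypotheses is the relabelling of configurations along the shift by `-a`
(`BondConfig.relabel (sym2Equiv (Site.shift (-a)))`, i.e. `ξ ↦ ξ - a`). [folklore] -/
theorem preimage_sym2Map_add_eq_relabel {d : ℕ} (a : Site d) :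
    (fun ξ : Set (Sym2 (Fin d → ℤ)) => Sym2.map (· + a) ⁻¹' ξ) =
      ⇑(BondConfig.relabel (sym2Equiv (Site.shift (-a)))) := by
  funext ξ
  ext z
  rw [BondConfig.mem_relabel_iff, sym2Equiv_symm, sym2Equiv_apply, Set.mem_preimage]
  have h : ⇑(Site.shift (-a)).symm = (· + a) := by
    funext x
    rw [Site.shift_symm_apply, sub_neg_eq_add]
  rw [h]

/-- **Translation invariance of `P_p` on `ℤ^d` in the route's form**: for every vector `a` and
every set `A` of configurations, `P_p {ξ | (· + a)⁻¹ ξ ∈ A} = P_p A` (no measurability needed: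
the translation is a measurable equivalence and `bondPercolation_map_shift`).
(Grimmett 1999, §1.6, p. 16.) [folklore] -/
theorem bondPercolation_preimage_translate {d : ℕ} (p : unitInterval) (a : Site d)
    (A : Set (Set (Sym2 (Fin d → ℤ)))) :
    bondPercolation (zdGraph d) p ((fun ξ : Set (Sym2 (Fin d → ℤ)) => Sym2.map (· + a) ⁻¹' ξ) ⁻¹' A) =
      bondPercolation (zdGraph d) p A := by
  rw [preimage_sym2Map_add_eq_relabel a, ← MeasurableEquiv.map_apply, bondPercolation_map_shift]

/-- **Item `stmt-CriticalPhenomena-5263` (`PercThresholdOne.IsoperimetricClosing`), proved.**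
GenDembin (vanishing anchored profile for stationary weaving laws) + weaving of the critical
configuration + same-`p` anchored isoperimetry of percolating clusters ⇒ `θ_{ℤ³}(p_c) = 0`.
If `θ(p_c) > 0`, apply GenDembin to `P_{p_c}` (a translation-invariant probability measure supported on
lattice edges, weaving by hypothesis) and the isoperimetry hypothesis at `p = p_c`: on `{|C(0)| = ∞}`
the two bounds `c₀|K| ≤ n|∂°K| ≤ (c₀/2)|K|` for some valid `K ∋ 0` are contradictory, so `|C(0)| < ∞`
a.s. and `θ(p_c) = 0`. (Cerf–Dembin 2020, Thm 1.2 and its corollary discussion.) [folklore] -/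
theorem isoperimetricClosing_proof :
    Summit.CriticalPhenomena.PercolationContinuityZ3.Theses.PercThresholdOne.IsoperimetricClosing := by
  unfold Summit.CriticalPhenomena.PercolationContinuityZ3.Theses.PercThresholdOne.IsoperimetricClosing
  intro hGD hWeave hIso
  -- `PercolationContinuityZ3` is `θ (zdGraph 3) 0 p_c = 0`; argue by contradiction.
  refine percolationContinuityZ3_iff.mpr ?_
  by_contra hne
  have h0 : 0 ≤ theta (zdGraph 3) (0 : Site 3) (criticalProbI 3) := by
    unfold theta
    exact measureReal_nonneg
  have hpos : 0 < theta (zdGraph 3) (0 : Site 3) (criticalProbI 3) :=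
    lt_of_le_of_ne h0 (fun h => hne h.symm)
  -- the inputs of GenDembin for `P_{p_c}`
  have hsub : ∀ᵐ ξ ∂(bondPercolation (zdGraph 3) (criticalProbI 3)), ξ ⊆ (zdGraph 3).edgeSet :=
    ProbabilityTheory.setBernoulli_ae_subset
  have h1 := hGD (bondPercolation (zdGraph 3) (criticalProbI 3)) inferInstance
    (fun a A _ => bondPercolation_preimage_translate (criticalProbI 3) a A)
    (by filter_upwards [hsub, hWeave] with ξ h h' using ⟨h, h'⟩)
  have h3 := hIso (criticalProbI 3) hpos
  -- a.s. the cluster of the origin is finite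
  have hfin : ∀ᵐ ω ∂(bondPercolation (zdGraph 3) (criticalProbI 3)),
      ω ∉ (percolatesAt (0 : Site 3) : Set (BondConfig (Site 3))) := by
    filter_upwards [h1, h3] with ω hω1 hω3 hinf
    obtain ⟨c, hc, N, hN⟩ := hω3 hinf
    obtain ⟨n, hNn, K, h0K, hconn, hcard, hle⟩ := hω1 (c / 2) (half_pos hc) N
    have hge := hN n hNn K h0K hconn hcard
    have hKpos : (0 : ℝ) < K.card := by exact_mod_cast Finset.card_pos.mpr ⟨0, h0K⟩
    have hcK : 0 < c * K.card := mul_pos hc hKpos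
    linarith
  -- hence `θ(p_c) = 0`
  apply hne
  unfold theta
  rw [measureReal_def, measure_eq_zero_iff_ae_notMem.mpr hfin, ENNReal.toReal_zero]

end Summit.CriticalPhenomena.PercolationContinuityZ3.Theorems
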